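import Summits.BirchSwinnertonDyer.BirchSwinnertonDyer.Theorems.CMKolyvaginAtInertTwoCMKolyvaginConjectureAtInertTwoPositiveDepthGenusCharacterDescentAllLevels
import HarnessLib

/-!
# Crux `CMKolyvaginConjectureAtInertTwo` (stmt-BirchSwinnertonDyer-24648), open stub `stub_positiveDepth`:
# AT PRIME LEVEL THE CANONICAL CHARACTER SUM IS TWICE THE SIGNED GENUS TRACE — `y_χ = 2·G_χ`

Route `CMKolyvaginAtInertTwo` (cell `pub/bsd-eis`, seat `leafhand-bsd-cmkolyvaginatinert-4` g0); helper (`--supports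
stmt-BirchSwinnertonDyer-24648 --as helper`). THEOREMS ONLY; closes nothing; BSD is proved for no curve.

Consistency link between the prime-level dictionary (p796272 / p824044 / p824465: the canonical `y_χ = Σ_{g∈Gal(K[ℓ]/K)} χ(g)·g y(ℓ)`,
`P(ℓ) ∈ 2E ⟺ y_χ ∈ 4·(ι_θ(E^{(ℓ*)}(K)) ∪ {O})`) and the all-levels one (p824620 / p824964: the signed genus trace
`G_χ = Σ_{s∈S} χ(s)·s(𝒩 y)`, `P(n) ∈ 2E ⟺ G_χ ∈ 2·(ι_Θ(E^{(n*)}(K)) ∪ {O})`): at a prime level the two points differ by the factor `2`.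

* §1 (algebra) `sum_neg_one_pow_smul_eq_two_zsmul_normPart`: `Σ_{i≤ℓ} (−1)^i σ^i y = 2·Σ_{k<(ℓ+1)/2} σ^{2k} y` when `ℓ` is odd and
  the trace `Σ_{i≤ℓ} σ^i y` vanishes (even part `= 𝒩y`, odd part `= σ𝒩y = −𝒩y`); `finsum_chi_smul_eq_two_zsmul_signedTrace`:
  `Σᶠ_{g∈𝒢} χ(g)·g y = 2·Σ_{s∈S} χ(s)·s(𝒩 y)` for `𝒢 = S·⟨σ⟩`, `χ(gσ) = −χ(g)` (hand -1's `finsum_chi_smul_eq_sum_transversal`).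
* §2 `chiSum_eq_two_zsmul_genusTraceChi`: on the stub's frame at a CM-inert Zhang–Kolyvagin prime `ℓ`, for any `χ` odd on `σ_ℓ`,
  `y_χ = 2·G_χ` with `G_χ` written along `ℓ.primeFactorsList = [ℓ]` exactly as in p824620.

[cite: GrossLMS1991, §3 (3.5), Prop. 3.7 (1), §4 (4.1)]
-/

set_option linter.dupNamespace false -- `Summit.BirchSwinnertonDyer.BirchSwinnertonDyer.Theorems.…` (summit = sub)
set_option autoImplicit false

noncomputable section

open scoped Classical

namespace Summit.BirchSwinnertonDyer.BirchSwinnertonDyer.Theorems.CMKolyvaginConjecturePositiveDepth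

open Finset WeierstrassCurve NumberField Literature.NumberTheory.EllipticCurves
  Literature.NumberTheory.EllipticCurves.ModularForms
  Literature.NumberTheory.EllipticCurves.Rank1Residual

/-! ## §1 Algebra -/

section Algebra

variable {G : Type*} [Group G] {A : Type*} [AddCommGroup A] (ρ : G →* AddMonoid.End A)

/-- **`Σ_{i≤ℓ} (−1)^i σ^i y = 2·𝒩y`** for odd `ℓ`, `𝒩 = Σ_{k<(ℓ+1)/2} σ^{2k}`, when the trace `Σ_{i≤ℓ} σ^i y` vanishes: the alternating
sum is `(evens) − (odds) = 𝒩y − σ𝒩y` and `σ𝒩y = −𝒩y` (hand -1's `map_normPart_eq_neg_of_trace_eq_zero`). [folklore] -/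
theorem sum_neg_one_pow_smul_eq_two_zsmul_normPart (σ : G) {ℓ : ℕ} (hℓ : Odd ℓ) (y : A)
    (htr : ∑ i ∈ range (ℓ + 1), ρ (σ ^ i) y = 0) :
    ∑ i ∈ range (ℓ + 1), ((-1 : ℤ) ^ i) • ρ (σ ^ i) y = (2 : ℤ) • ∑ k ∈ range ((ℓ + 1) / 2), ρ ((σ ^ 2) ^ k) y := by
  have h : (∑ i ∈ range (ℓ + 1), ((-1 : ℤ) ^ i) • ρ (σ ^ i) y) +
      (2 : ℤ) • ∑ i ∈ (range (ℓ + 1)).filter Odd, ρ (σ ^ i) y = ∑ i ∈ range (ℓ + 1), ρ (σ ^ i) y :=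
    sum_neg_one_pow_smul_add_two_smul_sum_filter_odd (ℓ + 1) (fun i ↦ ρ (σ ^ i) y)
  rw [htr] at h
  have hY : ∑ i ∈ range (ℓ + 1), ((-1 : ℤ) ^ i) • ρ (σ ^ i) y =
      -((2 : ℤ) • ∑ i ∈ (range (ℓ + 1)).filter Odd, ρ (σ ^ i) y) := eq_neg_of_add_eq_zero_left h
  rw [hY, GenusKoly.sum_filter_odd_eq_map_sum_sq_pow, map_normPart_eq_neg_of_trace_eq_zero ρ σ hℓ y htr, smul_neg, neg_neg]

/-- **`Σᶠ_{g∈𝒢} χ(g)·g y = 2·Σ_{s∈S} χ(s)·s(𝒩y)`**: for a subgroup `𝒢`, `σ ∈ 𝒢` of odd-plus-one order `ℓ + 1` (`ℓ` odd), a transversal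
`S ⊆ 𝒢` of `⟨σ⟩`, `χ` with `χ(gσ) = −χ(g)`, and `y` with vanishing trace `Σ_{i≤ℓ} σ^i y = 0`. [folklore] -/
theorem finsum_chi_smul_eq_two_zsmul_signedTrace (𝒢 : Subgroup G) (σ : G) (hσ𝒢 : σ ∈ 𝒢) {ℓ : ℕ} (hℓ : Odd ℓ)
    (hm : orderOf σ = ℓ + 1) (S : Finset G) (hS : ∀ s ∈ S, s ∈ 𝒢)
    (hT : ∀ g ∈ 𝒢, ∃! s, s ∈ S ∧ g⁻¹ * s ∈ Subgroup.zpowers σ) (χ : G → ℤ) (hχ : ∀ g, χ (g * σ) = -χ g)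
    (y : A) (htr : ∑ i ∈ range (ℓ + 1), ρ (σ ^ i) y = 0) :
    ∑ᶠ g ∈ (𝒢 : Set G), χ g • ρ g y =
      (2 : ℤ) • ∑ s ∈ S, χ s • ρ s (∑ k ∈ range ((ℓ + 1) / 2), ρ ((σ ^ 2) ^ k) y) := by
  rw [finsum_chi_smul_eq_sum_transversal ρ 𝒢 σ hσ𝒢 hm (Nat.succ_ne_zero ℓ) S hS hT χ hχ y,
    sum_neg_one_pow_smul_eq_two_zsmul_normPart ρ σ hℓ y htr]
  conv_rhs => rw [Finset.smul_sum]
  refine Finset.sum_congr rfl fun s _ ↦ ?_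
  rw [map_zsmul, smul_comm]

end Algebra

variable {K : Type} [Field K] [NumberField K]

/-! ## §2 On the frame: `y_χ = 2·G_χ` at a CM-inert Kolyvagin prime -/

/-- **`y_χ = 2·G_χ` at prime level.** Frame of the stub (`W/ℚ` globally minimal with CM, `CMInert W 2`, `ρ̄_{W,2}` onto, `K` imaginary
quadratic with odd `d_K ≠ −3`, Heegner for `N_E`), `ℓ` a Zhang–Kolyvagin prime at `2` inert in `F`, `d` any datum of conductor `ℓ`,
`χ : Aut_ℚ(K[ℓ]) → ℤ` with `χ(gσ_ℓ) = −χ(g)`: the canonical character sum `y_χ = Σ_{g∈Gal(K[ℓ]/K)} χ(g)·g y(ℓ)` (p796272) equals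
`2·G_χ`, `G_χ = Σ_{s∈S} χ(s)·s(𝒩_ℓ y(ℓ))` the signed genus trace of p824620 written along `ℓ.primeFactorsList = [ℓ]`
(trace vanishing `Σ_{i≤ℓ} σ_ℓ^i y(ℓ) = a_ℓ y(1) = 0`, p794939). [cite: GrossLMS1991, §3 (3.5), Prop. 3.7 (1), §4 (4.1)] -/
theorem chiSum_eq_two_zsmul_genusTraceChi (W : WeierstrassCurve ℚ) [W.IsElliptic]
    [W.IsGloballyMinimal] [NeZero (W.conductorNorm ℤ)] (hCM : W.HasCM)
    (hK : IsImaginaryQuadratic K) (hodd : Odd (NumberField.discr K)) (h3 : NumberField.discr K ≠ -3)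
    (hH : SatisfiesHeegnerHypothesis (W.conductorNorm ℤ) K)
    {Dt : ModularParametrizationData W (W.conductorNorm ℤ)} {β : ℤ} {ι : K →+* ℂ} {ℓ : ℕ}
    (hℓK : Zhang2014.IsKolyvaginPrime (W.conductorNorm ℤ) W K 2 ℓ) (hℓF : CMInert W ℓ)
    (d : KolyvaginHeegnerData Dt β ι ℓ)
    (χ : (ringClassField K ι ℓ ≃ₐ[ℚ] ringClassField K ι ℓ) → ℤ) (hχ : ∀ g, χ (g * d.σ ℓ) = -χ g) :
    ∑ᶠ g ∈ (ringClassGal ι ℓ : Set (ringClassField K ι ℓ ≃ₐ[ℚ] ringClassField K ι ℓ)),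
        χ g • pointGalHom W (ringClassField K ι ℓ) g d.y =
      (2 : ℤ) • ∑ s ∈ d.S, χ s • pointGalHom W (ringClassField K ι ℓ) s (ℓ.primeFactorsList.foldr
        (fun q x ↦ ∑ k ∈ range ((q + 1) / 2), pointGalHom W (ringClassField K ι ℓ) ((d.σ q ^ 2) ^ k) x) d.y) := by
  have hℓ := hℓK.1
  have hinert : (Ideal.span {(ℓ : 𝓞 K)}).IsPrime := hℓK.2.2.2.2.1
  have hℓℓ : ℓ ∈ ℓ.primeFactors := Nat.mem_primeFactors.mpr ⟨hℓ, dvd_rfl, hℓ.ne_zero⟩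
  have hG : ringClassGalOver ι ℓ 1 = Subgroup.zpowers (d.σ ℓ) := by
    rw [d.zpowers_σ ℓ hℓℓ, Nat.div_self hℓ.pos]
  have hσ𝒢 : d.σ ℓ ∈ ringClassGal ι ℓ :=
    ringClassGalOver_le_ringClassGal ι ℓ 1 (by rw [hG]; exact Subgroup.mem_zpowers _)
  have hord := orderOf_σ_eq_succ_of_prime W hK hodd h3 hℓ hinert d
  rw [Nat.primeFactorsList_prime hℓ, List.foldr_cons, List.foldr_nil]
  exact finsum_chi_smul_eq_two_zsmul_signedTrace (pointGalHom W (ringClassField K ι ℓ)) (ringClassGal ι ℓ) (d.σ ℓ) hσ𝒢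
    (hℓ.odd_of_ne_two hℓK.2.2.2.1) hord d.S d.S_subset (fun g hg ↦ by simpa only [hG] using d.S_transversal g hg) χ hχ d.y
    (sum_range_pointGalHom_σ_pow_y_eq_zero W hCM hK hodd h3 hH hℓK hℓF d)

end Summit.BirchSwinnertonDyer.BirchSwinnertonDyer.Theorems.CMKolyvaginConjecturePositiveDepth

end
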